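import Literature.RepresentationTheory.Semisimple.Semisimplification
import Literature.NumberTheory.GaloisRepresentations.GaloisRep
import Mathlib.Topology.Instances.Matrix
import Mathlib.LinearAlgebra.Matrix.Basis
import HarnessLib

/-!
# Continuous semisimplification of framed representations in every rank
(crux `IrreducibilityBySelfDuality.IrreducibleGL3CM`, item stmt-Langlands-14327, line
`reducible-companion-dispatch`, stub `stub_continuousSemisimplification`)

For a topological group `G`, a topological field `k` and a CONTINUOUS homomorphism
`ψ : G →ₜ* GL_n(k)` (units topology on `GL_n(k)`), there is a continuous `ψ' : G →ₜ* GL_n(k)` whose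
representation on `kⁿ` is semisimple, with the same characteristic polynomials
`det(X - ψ'(g)) = det(X - ψ(g))` and with `ψ g = 1 → ψ' g = 1`
(`exists_continuous_semisimplification`).  This is the tree's abstract every-rank semisimplification
`Literature.RepresentationTheory.Semisimple.exists_semisimplification` (Curtis–Reiner I §16B; Bourbaki
A VIII § 20 n° 6; Deligne–Serre 1974, 6.12) with continuity carried through the dévissage: in a basis
adapted to a proper non-zero stable subspace the matrices of `ψ` are `P ψ(g) Q` for FIXED rectangular
matrices `P`, `Q` (`basis_toMatrix_mul_linearMap_toMatrix_mul_basis_toMatrix`), hence continuous in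
`g` together with their inverses `P ψ(g)⁻¹ Q` (`Units.continuous_coe_inv`), so the diagonal blocks are
continuous for the units topology (`Units.continuous_iff`), and so is a block-diagonal sum of continuous
homomorphisms (`Continuous.matrix_fromBlocks`, `Continuous.matrix_reindex`).  Specialised to
`Γ_K →ₜ* GL_n(ℚ̄_ℓ)` this is the registered stub `stub_continuousSemisimplification` of the line.

References: C. W. Curtis, I. Reiner, *Methods of Representation Theory* I (1981), §16B; N. Bourbaki,
*Algèbre* VIII (2012), § 20 n° 6; P. Deligne, J.-P. Serre, ASENS 7 (1974), 6.12.
-/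

noncomputable section

open scoped MatrixGroups
open Matrix Module
open Literature.RepresentationTheory.Semisimple Literature.NumberTheory.GaloisRepresentations

namespace Summit.Langlands.Langlands.Theorems.IrreducibleGL3CM

universe u v

section General

variable {k : Type u} [Field k] [TopologicalSpace k] [IsTopologicalRing k]
  {G : Type v} [Group G] [TopologicalSpace G]

/-! ### Continuous block-diagonal sums -/

omit [IsTopologicalRing k] in
/-- The block-diagonal sum of two CONTINUOUS `GL`-valued homomorphisms, reindexed along
`e : Fin m ⊕ Fin p ≃ Fin n`, is a continuous homomorphism `G →ₜ* GL_n(k)` (units topology: both the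
matrix and its inverse `= ` the block-diagonal sum of the inverses depend continuously on `g`).
[folklore] -/
theorem exists_blockDiag_continuousHom {m p n : ℕ} (e : Fin m ⊕ Fin p ≃ Fin n)
    (A : G →ₜ* GL (Fin m) k) (D : G →ₜ* GL (Fin p) k) :
    ∃ ψ : G →ₜ* GL (Fin n) k, ∀ g, ((ψ g : GL (Fin n) k) : Matrix (Fin n) (Fin n) k) =
      Matrix.reindex e e (Matrix.fromBlocks ((A g : GL (Fin m) k) : Matrix (Fin m) (Fin m) k) 0 0
        ((D g : GL (Fin p) k) : Matrix (Fin p) (Fin p) k)) := by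
  obtain ⟨ψ₀, hψ₀⟩ := exists_blockDiag_hom (k := k) e A.toMonoidHom D.toMonoidHom
  have hval : Continuous fun g ↦ ((ψ₀ g : GL (Fin n) k) : Matrix (Fin n) (Fin n) k) := by
    simp only [hψ₀]
    exact ((Units.continuous_val.comp A.continuous_toFun).matrix_fromBlocks continuous_const
      continuous_const (Units.continuous_val.comp D.continuous_toFun)).matrix_reindex e e
  have hinv : Continuous fun g ↦ (((ψ₀ g)⁻¹ : GL (Fin n) k) : Matrix (Fin n) (Fin n) k) := by
    have h1 : (fun g ↦ (((ψ₀ g)⁻¹ : GL (Fin n) k) : Matrix (Fin n) (Fin n) k)) = fun g ↦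
        Matrix.reindex e e (Matrix.fromBlocks (((A g)⁻¹ : GL (Fin m) k) : Matrix (Fin m) (Fin m) k)
          0 0 (((D g)⁻¹ : GL (Fin p) k) : Matrix (Fin p) (Fin p) k)) := by
      funext g
      rw [← map_inv, hψ₀ g⁻¹, map_inv, map_inv]
      rfl
    rw [h1]
    exact ((Units.continuous_coe_inv.comp A.continuous_toFun).matrix_fromBlocks continuous_const
      continuous_const (Units.continuous_coe_inv.comp D.continuous_toFun)).matrix_reindex e e
  exact ⟨⟨ψ₀, Units.continuous_iff.2 ⟨hval, hinv⟩⟩, hψ₀⟩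

/-! ### Continuous dévissage -/

/-- **Continuous dévissage step.**  If the representation of `G` on `kⁿ` through a continuous
`ψ : G →ₜ* GL_n(k)` has a proper non-zero subrepresentation `W`, then in a basis adapted to a
decomposition `kⁿ = W ⊕ C` the matrices of `ψ` are block upper triangular with CONTINUOUS diagonal
blocks `A : G →ₜ* GL_m(k)`, `D : G →ₜ* GL_p(k)` (`0 < m, p < n`),
`det(X - ψ(g)) = det(X - A(g)) · det(X - D(g))` and `ψ g = 1 → A g = 1 ∧ D g = 1`.  The proof is the
tree's `exists_blocks_of_subrepresentation` with continuity added: the adapted matrices are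
`P ψ(g) Q` for fixed `P`, `Q`.  Curtis–Reiner, *Methods* I, §16B. [folklore] -/
theorem exists_continuous_blocks_of_subrepresentation {n : ℕ} (ψ : G →ₜ* GL (Fin n) k)
    (W : Subrepresentation
      ((Representation.ofDistribMulAction k (GL (Fin n) k) (Fin n → k)).comp ψ.toMonoidHom))
    (hW0 : W ≠ ⊥) (hW1 : W ≠ ⊤) :
    ∃ (m p : ℕ) (_ : m < n) (_ : p < n) (_ : Fin m ⊕ Fin p ≃ Fin n) (A : G →ₜ* GL (Fin m) k)
      (D : G →ₜ* GL (Fin p) k),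
      (∀ g, ((ψ g : GL (Fin n) k) : Matrix (Fin n) (Fin n) k).charpoly =
        ((A g : GL (Fin m) k) : Matrix (Fin m) (Fin m) k).charpoly *
          ((D g : GL (Fin p) k) : Matrix (Fin p) (Fin p) k).charpoly) ∧
      ∀ g, ψ g = 1 → A g = 1 ∧ D g = 1 := by
  classical
  -- the representation `R` on `kⁿ` (a `let`, definitionally the composite of which `W` is a
  -- subrepresentation)
  let R : Representation k G (Fin n → k) :=
    (Representation.ofDistribMulAction k (GL (Fin n) k) (Fin n → k)).comp ψ.toMonoidHom
  have hRapply : ∀ (g : G) (v : Fin n → k),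
      R g v = ((ψ g : GL (Fin n) k) : Matrix (Fin n) (Fin n) k) *ᵥ v := fun _ _ ↦ rfl
  have hRlin : ∀ g, (R g : (Fin n → k) →ₗ[k] (Fin n → k)) =
      Matrix.toLin' ((ψ g : GL (Fin n) k) : Matrix (Fin n) (Fin n) k) := fun g ↦
    LinearMap.ext fun v ↦ by rw [Matrix.toLin'_apply, hRapply]
  -- the stable subspace `W` and a complement `C`
  have hbot : (⊥ : Subrepresentation R).toSubmodule = ⊥ := rfl
  have htop : (⊤ : Subrepresentation R).toSubmodule = ⊤ := rfl
  have hWS0 : W.toSubmodule ≠ ⊥ := fun h ↦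
    hW0 (Subrepresentation.toSubmodule_injective (h.trans hbot.symm))
  have hWS1 : W.toSubmodule ≠ ⊤ := fun h ↦
    hW1 (Subrepresentation.toSubmodule_injective (h.trans htop.symm))
  obtain ⟨C, hWC⟩ := Submodule.exists_isCompl W.toSubmodule
  obtain ⟨m, hm⟩ : ∃ m, finrank k W.toSubmodule = m := ⟨_, rfl⟩
  obtain ⟨p, hp⟩ : ∃ p, finrank k C = p := ⟨_, rfl⟩
  have hmp : m + p = n := by
    rw [← hm, ← hp, Submodule.finrank_add_eq_of_isCompl hWC, Module.finrank_fin_fun]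
  have hm0 : 0 < m := by
    refine Nat.pos_of_ne_zero fun h ↦ hWS0 ?_
    exact Submodule.finrank_eq_zero.mp (hm.trans h)
  have hp0 : 0 < p := by
    refine Nat.pos_of_ne_zero fun h ↦ hWS1 ?_
    have hC : C = ⊥ := Submodule.finrank_eq_zero.mp (hp.trans h)
    have := hWC.sup_eq_top
    rwa [hC, sup_bot_eq] at this
  have hmn : m < n := by omega
  have hpn : p < n := by omega
  -- an adapted basis `b`
  let bW : Module.Basis (Fin m) k W.toSubmodule := Module.finBasisOfFinrankEq k W.toSubmodule hm
  let bC : Module.Basis (Fin p) k C := Module.finBasisOfFinrankEq k C hp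
  let f : (W.toSubmodule × C) ≃ₗ[k] (Fin n → k) := Submodule.prodEquivOfIsCompl W.toSubmodule C hWC
  let b : Module.Basis (Fin m ⊕ Fin p) k (Fin n → k) := (bW.prod bC).map f
  have hrepr : ∀ w : Fin n → k, w ∈ W.toSubmodule → ∀ i : Fin p, b.repr w (Sum.inr i) = 0 := by
    intro w hw i
    have h1 : b.repr w = (bW.prod bC).repr (f.symm w) := by
      simp only [b, Module.Basis.map_repr, LinearEquiv.trans_apply]
    have h2 : f.symm w = ((⟨w, hw⟩ : W.toSubmodule), 0) :=
      Submodule.prodEquivOfIsCompl_symm_apply_left (p := W.toSubmodule) (q := C) hWC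
        (⟨w, hw⟩ : W.toSubmodule)
    rw [h1, h2, Module.Basis.prod_repr_inr]
    simp
  have hb_inl : ∀ j : Fin m, (b (Sum.inl j) : Fin n → k) ∈ W.toSubmodule := by
    intro j
    have : b (Sum.inl j) = f ((bW.prod bC) (Sum.inl j)) := by simp [b]
    rw [this, Submodule.coe_prodEquivOfIsCompl', Module.Basis.prod_apply_inl_fst,
      Module.Basis.prod_apply_inl_snd]
    simp
  -- matrices in the adapted basis: `M g = P ψ(g) Q` for fixed `P`, `Q`
  let e₀ : Module.Basis (Fin n) k (Fin n → k) := Pi.basisFun k (Fin n)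
  let P : Matrix (Fin m ⊕ Fin p) (Fin n) k := b.toMatrix e₀
  let Q : Matrix (Fin n) (Fin m ⊕ Fin p) k := e₀.toMatrix b
  let M : G → Matrix (Fin m ⊕ Fin p) (Fin m ⊕ Fin p) k := fun g ↦ LinearMap.toMatrix b b (R g)
  have hM_eq : ∀ g, M g = P * ((ψ g : GL (Fin n) k) : Matrix (Fin n) (Fin n) k) * Q := by
    intro g
    have h1 : LinearMap.toMatrix e₀ e₀ (R g : (Fin n → k) →ₗ[k] (Fin n → k)) =
        ((ψ g : GL (Fin n) k) : Matrix (Fin n) (Fin n) k) := by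
      rw [hRlin, show LinearMap.toMatrix e₀ e₀ = LinearMap.toMatrix' from
        LinearMap.toMatrix_eq_toMatrix', LinearMap.toMatrix'_toLin']
    simp only [M, P, Q]
    rw [← h1, basis_toMatrix_mul_linearMap_toMatrix_mul_basis_toMatrix]
  have hM_inv : ∀ g, M g⁻¹ = P * (((ψ g)⁻¹ : GL (Fin n) k) : Matrix (Fin n) (Fin n) k) * Q := by
    intro g
    rw [hM_eq, map_inv]
  have hM_cont : Continuous M := by
    rw [show M = fun g ↦ P * ((ψ g : GL (Fin n) k) : Matrix (Fin n) (Fin n) k) * Q from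
      funext hM_eq]
    exact (continuous_const.matrix_mul (Units.continuous_val.comp ψ.continuous_toFun)).matrix_mul
      continuous_const
  have hM_cont_inv : Continuous fun g ↦ M g⁻¹ := by
    rw [show (fun g ↦ M g⁻¹) = fun g ↦
      P * (((ψ g)⁻¹ : GL (Fin n) k) : Matrix (Fin n) (Fin n) k) * Q from funext hM_inv]
    exact (continuous_const.matrix_mul (Units.continuous_coe_inv.comp ψ.continuous_toFun)).matrix_mul
      continuous_const
  have hM_mul : ∀ g h, M (g * h) = M g * M h := fun g h ↦ by
    simp only [M, map_mul]
    exact LinearMap.toMatrix_mul b _ _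
  have hM_one : M 1 = 1 := by
    simp only [M, map_one]
    exact LinearMap.toMatrix_one b
  have hM_charpoly : ∀ g, (M g).charpoly =
      ((ψ g : GL (Fin n) k) : Matrix (Fin n) (Fin n) k).charpoly := fun g ↦ by
    simp only [M]
    rw [LinearMap.charpoly_toMatrix, hRlin, Matrix.charpoly_toLin']
  have h21 : ∀ g, (M g).toBlocks₂₁ = 0 := by
    intro g
    ext i j
    change M g (Sum.inr i) (Sum.inl j) = 0
    simp only [M, LinearMap.toMatrix_apply]
    exact hrepr _ (W.apply_mem_toSubmodule g (hb_inl j)) i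
  -- the diagonal blocks are multiplicative and continuous
  let A₀ : G → Matrix (Fin m) (Fin m) k := fun g ↦ (M g).toBlocks₁₁
  let B₀ : G → Matrix (Fin m) (Fin p) k := fun g ↦ (M g).toBlocks₁₂
  let D₀ : G → Matrix (Fin p) (Fin p) k := fun g ↦ (M g).toBlocks₂₂
  have hA₀_cont : Continuous A₀ :=
    continuous_matrix fun i j ↦ hM_cont.matrix_elem (Sum.inl i) (Sum.inl j)
  have hD₀_cont : Continuous D₀ :=
    continuous_matrix fun i j ↦ hM_cont.matrix_elem (Sum.inr i) (Sum.inr j)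
  have hA₀_cont_inv : Continuous fun g ↦ A₀ g⁻¹ :=
    continuous_matrix fun i j ↦ hM_cont_inv.matrix_elem (Sum.inl i) (Sum.inl j)
  have hD₀_cont_inv : Continuous fun g ↦ D₀ g⁻¹ :=
    continuous_matrix fun i j ↦ hM_cont_inv.matrix_elem (Sum.inr i) (Sum.inr j)
  have hblock : ∀ g, M g = Matrix.fromBlocks (A₀ g) (B₀ g) 0 (D₀ g) := fun g ↦ by
    conv_lhs => rw [← Matrix.fromBlocks_toBlocks (M g), h21 g]
  have hmul : ∀ g h, A₀ (g * h) = A₀ g * A₀ h ∧ D₀ (g * h) = D₀ g * D₀ h := by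
    intro g h
    have e1 := hM_mul g h
    rw [hblock, hblock, hblock, Matrix.fromBlocks_multiply] at e1
    obtain ⟨hA, -, -, hD⟩ := Matrix.fromBlocks_inj.mp e1
    refine ⟨?_, ?_⟩
    · rw [hA, Matrix.mul_zero, add_zero]
    · rw [hD, Matrix.zero_mul, zero_add]
  have hone : A₀ 1 = 1 ∧ D₀ 1 = 1 := by
    have e1 := hM_one
    rw [hblock, ← Matrix.fromBlocks_one] at e1
    obtain ⟨hA, -, -, hD⟩ := Matrix.fromBlocks_inj.mp e1
    exact ⟨hA, hD⟩
  have hker : ∀ g, ψ g = 1 → A₀ g = 1 ∧ D₀ g = 1 := by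
    intro g hg
    have hRg : R g = 1 := by
      change Representation.ofDistribMulAction k (GL (Fin n) k) (Fin n → k) (ψ g) = 1
      rw [hg, map_one]
    have e1 : M g = 1 := by simp only [M, hRg]; exact LinearMap.toMatrix_one b
    rw [hblock, ← Matrix.fromBlocks_one] at e1
    obtain ⟨hA, -, -, hD⟩ := Matrix.fromBlocks_inj.mp e1
    exact ⟨hA, hD⟩
  -- as continuous homomorphisms into `GL`
  let A : G →ₜ* GL (Fin m) k :=
    { toFun := fun g ↦ ⟨A₀ g, A₀ g⁻¹, by rw [← (hmul _ _).1, mul_inv_cancel, hone.1],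
        by rw [← (hmul _ _).1, inv_mul_cancel, hone.1]⟩
      map_one' := Units.ext hone.1
      map_mul' := fun g h ↦ Units.ext (hmul g h).1
      continuous_toFun := Units.continuous_iff.2 ⟨hA₀_cont, hA₀_cont_inv⟩ }
  let D : G →ₜ* GL (Fin p) k :=
    { toFun := fun g ↦ ⟨D₀ g, D₀ g⁻¹, by rw [← (hmul _ _).2, mul_inv_cancel, hone.2],
        by rw [← (hmul _ _).2, inv_mul_cancel, hone.2]⟩
      map_one' := Units.ext hone.2
      map_mul' := fun g h ↦ Units.ext (hmul g h).2
      continuous_toFun := Units.continuous_iff.2 ⟨hD₀_cont, hD₀_cont_inv⟩ }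
  refine ⟨m, p, hmn, hpn, finSumFinEquiv.trans (finCongr hmp), A, D, fun g ↦ ?_, fun g hg ↦ ?_⟩
  · rw [← hM_charpoly, hblock, Matrix.charpoly_fromBlocks_zero₂₁]
    rfl
  · exact ⟨Units.ext (hker g hg).1, Units.ext (hker g hg).2⟩

/-! ### The continuous semisimplification -/

/-- **Continuous semisimplification in every rank.**  For every CONTINUOUS homomorphism
`ψ : G →ₜ* GL_n(k)` of a topological group into `GL_n` of a topological field (units topology) there
is a continuous `ψ' : G →ₜ* GL_n(k)` whose representation on `kⁿ` is semisimple, with the same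
characteristic polynomials `det(X - ψ'(g)) = det(X - ψ(g))` and with `ψ g = 1 → ψ' g = 1`.  Strong
induction on `n` exactly as in the abstract `exists_semisimplification`: if `kⁿ` is not semisimple,
continuous dévissage (`exists_continuous_blocks_of_subrepresentation`) along a proper non-zero stable
subspace and the continuous block-diagonal sum (`exists_blockDiag_continuousHom`) of semisimplifications
of the two diagonal blocks (`isSemisimpleRepresentation_of_blockDiag`).  Curtis–Reiner I §16B; Bourbaki
A VIII § 20 n° 6; Deligne–Serre 1974, 6.12. [folklore] -/
theorem exists_continuous_semisimplification {n : ℕ} (ψ : G →ₜ* GL (Fin n) k) :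
    ∃ ψ' : G →ₜ* GL (Fin n) k,
      Representation.IsSemisimpleRepresentation
        ((Representation.ofDistribMulAction k (GL (Fin n) k) (Fin n → k)).comp ψ'.toMonoidHom) ∧
      (∀ g, ((ψ' g : GL (Fin n) k) : Matrix (Fin n) (Fin n) k).charpoly =
        ((ψ g : GL (Fin n) k) : Matrix (Fin n) (Fin n) k).charpoly) ∧
      ∀ g, ψ g = 1 → ψ' g = 1 := by
  induction n using Nat.strong_induction_on with
  | _ n ih =>
    classical
    by_cases hss : Representation.IsSemisimpleRepresentation
        ((Representation.ofDistribMulAction k (GL (Fin n) k) (Fin n → k)).comp ψ.toMonoidHom)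
    · exact ⟨ψ, hss, fun _ ↦ rfl, fun _ h ↦ h⟩
    obtain ⟨W, hW0, hW1⟩ := exists_ne_bot_ne_top_of_not_isSemisimpleRepresentation _ hss
    obtain ⟨m, p, hmn, hpn, e, A, D, hcp, hker⟩ :=
      exists_continuous_blocks_of_subrepresentation ψ W hW0 hW1
    obtain ⟨A', hA'ss, hA'cp, hA'ker⟩ := ih m hmn A
    obtain ⟨D', hD'ss, hD'cp, hD'ker⟩ := ih p hpn D
    obtain ⟨ψ', hψ'⟩ := exists_blockDiag_continuousHom (k := k) e A' D'
    refine ⟨ψ', ?_, fun g ↦ ?_, fun g hg ↦ ?_⟩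
    · exact isSemisimpleRepresentation_of_blockDiag e (A := A'.toMonoidHom) (D := D'.toMonoidHom)
        (ψ := ψ'.toMonoidHom) hψ' hA'ss hD'ss
    · rw [hψ' g, Matrix.charpoly_reindex, Matrix.charpoly_fromBlocks_zero₂₁, hA'cp, hD'cp, hcp]
    · have hA1 : A' g = 1 := hA'ker g (hker g hg).1
      have hD1 : D' g = 1 := hD'ker g (hker g hg).2
      refine Units.ext ?_
      rw [hψ' g, hA1, hD1, Units.val_one, Units.val_one, Matrix.fromBlocks_one, Units.val_one,
        Matrix.reindex_apply, Matrix.submatrix_one_equiv]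

end General

/-! ### The registered stub -/

/-- **Stub `stub_continuousSemisimplification`** of the line `reducible-companion-dispatch` for the crux
`IrreducibleGL3CM`: every framed Galois representation `r₀ : Γ_K →ₜ* GL_n(ℚ̄_ℓ)` has a continuous
semisimplification `r` — semisimple (`r.toGaloisRep.IsSemisimple`), with the same characteristic
polynomials `FramedRep.charpoly r g = FramedRep.charpoly r₀ g`, and trivial wherever `r₀` is (so that
unramifiedness and Frobenius characteristic polynomials are inherited).  Immediate from
`exists_continuous_semisimplification` with `G = Γ_K`, `k = ℚ̄_ℓ`. [folklore] -/
theorem stub_continuousSemisimplification : ∀ (K : Type) [Field K] (ℓ : ℕ) [Fact ℓ.Prime] (n : ℕ) (r₀ : FramedGaloisRep K (PadicAlgCl ℓ) n), ∃ r : FramedGaloisRep K (PadicAlgCl ℓ) n, r.toGaloisRep.IsSemisimple ∧ (∀ g, FramedRep.charpoly r g = FramedRep.charpoly r₀ g) ∧ (∀ g, r₀ g = 1 → r g = 1) := by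
  intro K _ ℓ _ n r₀
  obtain ⟨r, hss, hcp, hker⟩ := exists_continuous_semisimplification (k := PadicAlgCl ℓ) r₀
  exact ⟨r, hss, hcp, hker⟩

end Summit.Langlands.Langlands.Theorems.IrreducibleGL3CM

end
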